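import Summits.BirchSwinnertonDyer.BirchSwinnertonDyer.Theorems.AlignedTransportAtTwoMainConjectureOfRankZeroBSDAtTwoCubicLayerOneDoors
import Summits.BirchSwinnertonDyer.BirchSwinnertonDyer.Theorems.AlignedTransportAtTwoMainConjectureOfRankZeroBSDAtTwoFineRoadRealKummerLinesPadicLetterOnPointsPrimes
import Summits.BirchSwinnertonDyer.BirchSwinnertonDyer.Theorems.AlignedTransportAtTwoMainConjectureTransportAlignedAtTwoKilfordStratumShared
import HarnessLib

/-!
# Route `AlignedTransportAtTwo`, crux C2 `MainConjectureOfRankZeroBSDAtTwo` (stmt-BirchSwinnertonDyer-22298):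
# THE DICTIONARY'S KERNEL HALF — ON the Kilford stratum (`Δ_min ≡ 1 (mod 8)`) the cubic `2`-torsion field has THREE primes above `2`;
# the displayed bit `h3p` of the layer-`(n, n+1)` doors (att-p5 g25 `…CubicLayerOneDoors`) is DISCHARGED

HONEST FRAMING (cell `bsd-f1-sign2`, WIDTH-5 attached prover seat `bsd-line-att-p5` gen 26 on line `birth` of the lead `bsd-line-att-p2`;
`--supports` stmt-BirchSwinnertonDyer-22298, closes nothing; BSD is NOT proved by any of this; the crux C2, its verdict «blocked-on
`Rank1Residual.GreenbergMuConjectureIrreducible`» and every registered stub are untouched). THEOREMS ONLY — no definition, no named fact,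
no `sorry`. Tree-internal glue: the `2`-adic root structure ON the stratum (att-p5 g15 `…LetterSwitchStratum.exists_padic_roots`: for a globally
minimal good-ordinary `V` ON the stratum, `c_V(z) = (z − y₁)(z − y₂)(z − y₃)` on `ℚ₂` with `‖y₁‖ = 1`, `‖y₂‖, ‖y₃‖ ≤ 1/4`, `‖y₂ − y₃‖ = 1/16`),
the embedding ↦ prime plumbing (att-p5 g16 `…PadicLetterOnPointsPrimes.heightOneSpectrum_ne_of_apply_ne`, g14 `…AlignedTransportAtTwoBridge.
exists_heightOneSpectrum_of_ringHom_padic`) and the decidable dictionary (`…KilfordStratumShared.onKilfordStratumAtTwo_iff_minimalDiscriminantInt_emod_eight`: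
for good-ordinary `W`, ON the stratum ⟺ `Δ_min(W) ≡ 1 (mod 8)`).

WHAT.
* §1 **`three_le_ncard_of_onKilfordStratumAtTwo`**: `V/ℚ` globally minimal, good ORDINARY at `2`, `E_V(ℚ)[2] = 0`, ON the Kilford stratum, `F` ANY
  cubic number field with a root `e₁` of the `u`-cubic `c_V = X³ + b₂X² + 8b₄X + 16b₆` ⟹ `3 ≤ #{v : height-one primes of 𝓞 F ∋ 2}` (three pairwise
  distinct `ℚ₂`-roots ⟹ three power-basis embeddings `F → ℚ₂` ⟹ three distinct primes); **`ncard_eq_three_of_onKilfordStratumAtTwo`** (`= 3`, by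
  `Σ eᵢfᵢ = 3`); the `Δ_min ≡ 1 (mod 8)` forms.
* §2 the `ℚ(β)` currency of the g24/g25 files (`β` a root of `W.twoTorsionPolynomial = 4x³ + b₂x² + 2b₄x + b₆` in `ℚ̄`, `e₁ = 4β`):
  **`three_le_ncard_adjoin_root_twoTorsionPolynomial_of_onKilfordStratumAtTwo`** — VERBATIM the hypothesis `h3p` of `…CubicLayerOneDoors` §4.
* §3 RE-STAMPED with `h3p` discharged: **`classNumberPExp_one_ne_zero_seedCubicField_of_onKilfordStratumAtTwo`** (NO layer-`(0,1)` certificate on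
  the whole Kilford sub-cell `{good ordinary at 2, E(ℚ)[2] = 0, Δ < 0, Δ_min ≡ 1 (8)}` of the seed cell — kernel, no displayed bit) and the
  layer-`(n, n+1)` doors **`mazurMainConjecture_two_of_muIneqRel_of_onKilfordStratumAtTwo_of_classNumberPExp_succ_eq`** /
  **`…_of_classGroupPRank_succ_eq`** (PRINT⁵ + MuIneqʳ verbatim + cell hypotheses + ON the stratum + ONE class-group equality along the
  cyclotomic tower of `ℚ(β)` ⟹ `MC₂(W)`), and their `minimalDiscriminantInt W % 8 = 1` forms (decidable per curve).

Nothing is asserted about any seed's class groups; nothing is closed; BSD is not proved.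

References: [NeukirchANT1999] Ch. II §8 (8.1)–(8.3), Ch. I §8 Prop. (8.2); [SilvermanAEC2009] III.1, IV.§3, VII.2, VIII.8; [Serre1973] Ch. II
§3.3 Thm. 4; [Fukuda1994] Thm. 1 (1)(2), p. 264; [Lang1990] Ch. 13 §4, Lemma 4.1; [Kato2004Asterisque] Thm. 17.4; [GreenbergLNM1716] Conj. 1.11,
Thm. 4.1; tree p743166 (att-p5 g25), p739408 (g24), g16 `…PadicLetterOnPointsPrimes`, g15 `…LetterSwitchStratum`.
-/

set_option linter.dupNamespace false
set_option autoImplicit false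

noncomputable section

open scoped Classical NumberField nonZeroDivisors

namespace Summit.BirchSwinnertonDyer.BirchSwinnertonDyer.Theorems.AlignedTransportAtTwoCubicKilfordPrimes

open NumberField IsDedekindDomain Polynomial WeierstrassCurve IntermediateField
  Literature.NumberTheory.EllipticCurves Literature.NumberTheory.EllipticCurves.Greenberg1999
  Summit.BirchSwinnertonDyer.Rank1Residual.F1Sign2
  Summit.BirchSwinnertonDyer.BirchSwinnertonDyer.Theorems.AlignedTransportAtTwoBridge
  Summit.BirchSwinnertonDyer.BirchSwinnertonDyer.Theorems.AlignedTransportAtTwoFineRoad.RealKummerLinesLetterSwitchStratum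
  Summit.BirchSwinnertonDyer.BirchSwinnertonDyer.Theorems.AlignedTransportAtTwoFineRoad.RealKummerLinesPadicLetterOnPointsPrimes
  Summit.BirchSwinnertonDyer.BirchSwinnertonDyer.Theorems.AlignedTransportAtTwoKilfordStratumShared

/-! ## §1 Three primes above `2` in any cubic field of the `u`-cubic, ON the Kilford stratum -/

section Cubic

variable (V : WeierstrassCurve ℚ) [V.IsGloballyMinimal] [V.IsElliptic]

/-- The set of height-one primes of `𝓞 F` containing `2` is finite (the prime factors of `(2) ≠ 0`). [folklore] -/
theorem finite_setOf_two_mem {F : Type*} [Field F] [NumberField F] :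
    {v : HeightOneSpectrum (𝓞 F) | ((2 : ℕ) : 𝓞 F) ∈ v.asIdeal}.Finite := by
  have h2 : ((2 : ℕ) : 𝓞 F) ≠ 0 := by exact_mod_cast (two_ne_zero : (2 : 𝓞 F) ≠ 0)
  have h := Ideal.finite_factors (I := Ideal.span {((2 : ℕ) : 𝓞 F)}) (by
    rw [Ne, Submodule.zero_eq_bot, Ideal.span_singleton_eq_bot]; exact h2)
  refine h.subset fun v hv ↦ ?_
  simp only [Set.mem_setOf_eq] at hv ⊢
  exact (Ideal.dvd_span_singleton).mpr hv

/-- **THREE PRIMES ABOVE `2` ON THE KILFORD STRATUM.** `V/ℚ` globally minimal with good ORDINARY reduction at `2`, no rational `2`-torsion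
abscissa, ON the Kilford stratum (the `u`-cubic `c_V = X³ + b₂X² + 8b₄X + 16b₆` splits over `ℚ₂`; for such `V` equivalently `Δ_min ≡ 1 (mod 8)`);
`F` any cubic number field with a root `e₁` of `c_V`. Then `𝓞 F` has at least three height-one primes containing `2`: the three `ℚ₂`-roots
`y₁, y₂, y₃` of `c_V` (`‖y₁‖ = 1`, `‖y₂‖, ‖y₃‖ ≤ 1/4`, `‖y₂ − y₃‖ = 1/16`) are pairwise distinct, the three power-basis embeddings `e₁ ↦ yᵢ`
cut out three primes `𝓞_{vᵢ} = σᵢ⁻¹(ℤ₂)`, and embeddings that differ at `e₁` cut out different primes (density of `ℚ` in `ℚ₂`).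
[cite: NeukirchANT1999, Ch. II §8, (8.1)–(8.3)] [cite: SilvermanAEC2009, IV.§3 and VII.2] -/
theorem three_le_ncard_of_onKilfordStratumAtTwo (hV : IsOrdinaryAt V 2) (ht : ∀ x : ℚ, ¬ HasRationalTwoTorsionX V x)
    (hs : OnKilfordStratumAtTwo V) {F : Type} [Field F] [NumberField F] (hF : Module.finrank ℚ F = 3) {e₁ : F}
    (he₁ : aeval e₁ (twoDivisionUCubic V) = 0) :
    3 ≤ {v : HeightOneSpectrum (𝓞 F) | ((2 : ℕ) : 𝓞 F) ∈ v.asIdeal}.ncard := by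
  obtain ⟨B₂, B₄, B₆, D, hb, hodd, hΔ, hD⟩ := exists_int_b_of_isOrdinaryAt_two V hV
  obtain ⟨hb2, hb4, hb6⟩ := hb
  obtain ⟨y₁, y₂, y₃, hprod, hy₁, hy₂, hy₃, hy₂₃⟩ := exists_padic_roots V ⟨hb2, hb4, hb6⟩ hodd hΔ hD hs
  -- the three roots are pairwise distinct
  have h12 : y₁ ≠ y₂ := fun h ↦ by rw [h] at hy₁; rw [hy₁] at hy₂; norm_num at hy₂
  have h13 : y₁ ≠ y₃ := fun h ↦ by rw [h] at hy₁; rw [hy₁] at hy₃; norm_num at hy₃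
  have h23 : y₂ ≠ y₃ := fun h ↦ by rw [h, sub_self, norm_zero] at hy₂₃; norm_num at hy₂₃
  -- the power basis on `e₁`
  have hmin : minpoly ℚ e₁ = twoDivisionUCubic V := minpoly_eq_twoDivisionUCubic V ht he₁
  obtain ⟨pb, hgen, -⟩ := exists_powerBasis_gen_eq (natDegree_twoDivisionUCubic V) hF hmin
  have hroot : ∀ y : ℚ_[2], (y - y₁) * (y - y₂) * (y - y₃) = 0 → aeval y (minpoly ℚ pb.gen) = 0 := by
    intro y hy
    rw [hgen, hmin]
    simp only [twoDivisionUCubic, map_add, map_mul, map_pow, aeval_X, aeval_C, eq_ratCast, hb2, hb4, hb6]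
    push_cast
    rw [← hprod y] at hy
    linear_combination hy
  have hr₁ : (y₁ - y₁) * (y₁ - y₂) * (y₁ - y₃) = 0 := by ring
  have hr₂ : (y₂ - y₁) * (y₂ - y₂) * (y₂ - y₃) = 0 := by ring
  have hr₃ : (y₃ - y₁) * (y₃ - y₂) * (y₃ - y₃) = 0 := by ring
  set σ₁ : F →ₐ[ℚ] ℚ_[2] := pb.lift y₁ (hroot y₁ hr₁) with hσ₁
  set σ₂ : F →ₐ[ℚ] ℚ_[2] := pb.lift y₂ (hroot y₂ hr₂) with hσ₂
  set σ₃ : F →ₐ[ℚ] ℚ_[2] := pb.lift y₃ (hroot y₃ hr₃) with hσ₃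
  have hσe : σ₁ e₁ = y₁ ∧ σ₂ e₁ = y₂ ∧ σ₃ e₁ = y₃ := by
    refine ⟨?_, ?_, ?_⟩ <;> rw [← hgen] <;> exact pb.lift_gen _ _
  -- their primes
  obtain ⟨v₁, hv₁2, hv₁⟩ := exists_heightOneSpectrum_of_ringHom_padic (σ₁ : F →+* ℚ_[2])
  obtain ⟨v₂, hv₂2, hv₂⟩ := exists_heightOneSpectrum_of_ringHom_padic (σ₂ : F →+* ℚ_[2])
  obtain ⟨v₃, hv₃2, hv₃⟩ := exists_heightOneSpectrum_of_ringHom_padic (σ₃ : F →+* ℚ_[2])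
  have hne12 : v₁ ≠ v₂ := heightOneSpectrum_ne_of_apply_ne (σ₁ : F →+* ℚ_[2]) (σ₂ : F →+* ℚ_[2]) hv₁ hv₂ (x := e₁)
    (by change σ₁ e₁ ≠ σ₂ e₁; rw [hσe.1, hσe.2.1]; exact h12)
  have hne13 : v₁ ≠ v₃ := heightOneSpectrum_ne_of_apply_ne (σ₁ : F →+* ℚ_[2]) (σ₃ : F →+* ℚ_[2]) hv₁ hv₃ (x := e₁)
    (by change σ₁ e₁ ≠ σ₃ e₁; rw [hσe.1, hσe.2.2]; exact h13)
  have hne23 : v₂ ≠ v₃ := heightOneSpectrum_ne_of_apply_ne (σ₂ : F →+* ℚ_[2]) (σ₃ : F →+* ℚ_[2]) hv₂ hv₃ (x := e₁)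
    (by change σ₂ e₁ ≠ σ₃ e₁; rw [hσe.2.1, hσe.2.2]; exact h23)
  -- count
  have h3 : ({v₁, v₂, v₃} : Set (HeightOneSpectrum (𝓞 F))).ncard = 3 :=
    Set.ncard_eq_three.mpr ⟨v₁, v₂, v₃, hne12, hne13, hne23, rfl⟩
  have hsub : ({v₁, v₂, v₃} : Set (HeightOneSpectrum (𝓞 F))) ⊆ {v : HeightOneSpectrum (𝓞 F) | ((2 : ℕ) : 𝓞 F) ∈ v.asIdeal} := by
    intro v hv
    simp only [Set.mem_insert_iff, Set.mem_singleton_iff] at hv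
    rcases hv with rfl | rfl | rfl <;> assumption
  rw [← h3]
  exact Set.ncard_le_ncard hsub finite_setOf_two_mem

/-- **EXACTLY three primes above `2` ON the stratum** (and so each has `e = f = 1`: tree `ramificationIdx_eq_one_of_three_le_ncard`): the lower
bound of `three_le_ncard_of_onKilfordStratumAtTwo` meets the fundamental identity `Σ_{P ∣ 2} e_P f_P = [F : ℚ] = 3`.
[cite: NeukirchANT1999, Ch. I §8 Prop. (8.2) and Ch. II §8 (8.2)] -/
theorem ncard_eq_three_of_onKilfordStratumAtTwo (hV : IsOrdinaryAt V 2) (ht : ∀ x : ℚ, ¬ HasRationalTwoTorsionX V x)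
    (hs : OnKilfordStratumAtTwo V) {F : Type} [Field F] [NumberField F] (hF : Module.finrank ℚ F = 3) {e₁ : F}
    (he₁ : aeval e₁ (twoDivisionUCubic V) = 0) :
    {v : HeightOneSpectrum (𝓞 F) | ((2 : ℕ) : 𝓞 F) ∈ v.asIdeal}.ncard = 3 := by
  refine le_antisymm ?_ (three_le_ncard_of_onKilfordStratumAtTwo V hV ht hs hF he₁)
  have hfin := finite_setOf_two_mem (F := F)
  rw [Set.ncard_eq_toFinset_card _ hfin, ← hF]
  exact card_le_finrank_of_forall_natCast_mem 2 hfin.toFinset fun v hv ↦ by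
    simpa using (Set.Finite.mem_toFinset hfin).mp hv

/-- The `Δ_min ≡ 1 (mod 8)` form (decidable per curve; tree `onKilfordStratumAtTwo_iff_minimalDiscriminantInt_emod_eight`).
[cite: Serre1973, Ch. II §3.3 Thm. 4] [cite: NeukirchANT1999, Ch. II §8, (8.1)–(8.3)] -/
theorem three_le_ncard_of_minimalDiscriminantInt_emod_eight (hV : IsOrdinaryAt V 2) (ht : ∀ x : ℚ, ¬ HasRationalTwoTorsionX V x)
    (h8 : minimalDiscriminantInt V % 8 = 1) {F : Type} [Field F] [NumberField F] (hF : Module.finrank ℚ F = 3) {e₁ : F}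
    (he₁ : aeval e₁ (twoDivisionUCubic V) = 0) :
    3 ≤ {v : HeightOneSpectrum (𝓞 F) | ((2 : ℕ) : 𝓞 F) ∈ v.asIdeal}.ncard :=
  three_le_ncard_of_onKilfordStratumAtTwo V hV ht ((onKilfordStratumAtTwo_iff_minimalDiscriminantInt_emod_eight V hV).mpr h8) hF he₁

end Cubic

/-! ## §2 The `ℚ(β)` currency: `β` a root of the `2`-division cubic `4x³ + b₂x² + 2b₄x + b₆` in `ℚ̄`, `e₁ = 4β` -/

section Adjoin

variable (W : WeierstrassCurve ℚ)

/-- In `ℚ(β)`, the generator satisfies `ψ_W(β) = 4β³ + b₂β² + 2b₄β + b₆ = 0` (read through `ℚ(β) ↪ ℚ̄`). [cite: SilvermanAEC2009, III.1] -/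
theorem psi_gen_eq_zero {β : AlgebraicClosure ℚ} (hβ : aeval β W.twoTorsionPolynomial.toPoly = 0) :
    4 * (AdjoinSimple.gen ℚ β) ^ 3 + (W.b₂ : ↥(IntermediateField.adjoin ℚ ({β} : Set (AlgebraicClosure ℚ)))) * (AdjoinSimple.gen ℚ β) ^ 2
      + 2 * (W.b₄ : ↥(IntermediateField.adjoin ℚ ({β} : Set (AlgebraicClosure ℚ)))) * (AdjoinSimple.gen ℚ β)
      + (W.b₆ : ↥(IntermediateField.adjoin ℚ ({β} : Set (AlgebraicClosure ℚ)))) = 0 := by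
  apply (algebraMap ↥(IntermediateField.adjoin ℚ ({β} : Set (AlgebraicClosure ℚ))) (AlgebraicClosure ℚ)).injective
  rw [map_zero, ← hβ]
  simp only [WeierstrassCurve.twoTorsionPolynomial, Cubic.toPoly, map_add, map_mul, map_pow, map_ofNat, map_ratCast,
    IntermediateField.AdjoinSimple.algebraMap_gen, aeval_C, aeval_X, eq_ratCast]

/-- `e₁ = 4β ∈ ℚ(β)` is a root of the `u`-cubic `c_W` (`c_W(4z) = 16 ψ_W(z)`). [cite: SilvermanAEC2009, III.1] -/
theorem aeval_four_mul_gen_twoDivisionUCubic {β : AlgebraicClosure ℚ} (hβ : aeval β W.twoTorsionPolynomial.toPoly = 0) :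
    aeval (4 * (AdjoinSimple.gen ℚ β : ↥(IntermediateField.adjoin ℚ ({β} : Set (AlgebraicClosure ℚ))))) (twoDivisionUCubic W) = 0 :=
  (aeval_twoDivisionUCubic_four_mul_eq_zero_iff W _).mpr (psi_gen_eq_zero W hβ)

variable [W.IsElliptic] [W.IsGloballyMinimal]

/-- **`h3p` DISCHARGED.** For `W/ℚ` globally minimal with good ORDINARY reduction at `2`, no rational `2`-torsion abscissa, ON the Kilford
stratum, and `β ∈ ℚ̄` a root of `4x³ + b₂x² + 2b₄x + b₆`: the cubic field `ℚ(β)` has at least three height-one primes containing `2` —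
VERBATIM the hypothesis `h3p` of att-p5 g25's `…CubicLayerOneDoors` §4. [cite: NeukirchANT1999, Ch. II §8, (8.1)–(8.3)]
[cite: SilvermanAEC2009, IV.§3 and VII.2] -/
theorem three_le_ncard_adjoin_root_twoTorsionPolynomial_of_onKilfordStratumAtTwo (hord : IsOrdinaryAt W 2)
    (ht : ∀ x : ℚ, ¬ HasRationalTwoTorsionX W x) (hs : OnKilfordStratumAtTwo W)
    {β : AlgebraicClosure ℚ} (hβ : aeval β W.twoTorsionPolynomial.toPoly = 0) :
    3 ≤ {v : HeightOneSpectrum (𝓞 ↥(IntermediateField.adjoin ℚ ({β} : Set (AlgebraicClosure ℚ)))) |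
      ((2 : ℕ) : 𝓞 ↥(IntermediateField.adjoin ℚ ({β} : Set (AlgebraicClosure ℚ)))) ∈ v.asIdeal}.ncard := by
  have hirr := AlignedTransportAtTwoSeed.irr_two_of_forall_not_hasRationalTwoTorsionX W ht
  have hβint : IsIntegral ℚ β := ((AlgebraicClosure.isAlgebraic ℚ).isAlgebraic β).isIntegral
  haveI : FiniteDimensional ℚ ↥(IntermediateField.adjoin ℚ ({β} : Set (AlgebraicClosure ℚ))) :=
    IntermediateField.adjoin.finiteDimensional hβint
  haveI : NumberField ↥(IntermediateField.adjoin ℚ ({β} : Set (AlgebraicClosure ℚ))) := NumberField.mk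
  have h3 : Module.finrank ℚ ↥(IntermediateField.adjoin ℚ ({β} : Set (AlgebraicClosure ℚ))) = 3 :=
    AddKatoTwo.finrank_adjoin_root_twoTorsionPolynomial_eq_three W hirr hβ
  exact three_le_ncard_of_onKilfordStratumAtTwo W hord ht hs h3 (aeval_four_mul_gen_twoDivisionUCubic W hβ)

/-- The `Δ_min ≡ 1 (mod 8)` form of `h3p` (decidable per curve). [cite: Serre1973, Ch. II §3.3 Thm. 4] [cite: NeukirchANT1999, Ch. II §8] -/
theorem three_le_ncard_adjoin_root_twoTorsionPolynomial_of_minimalDiscriminantInt_emod_eight (hord : IsOrdinaryAt W 2)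
    (ht : ∀ x : ℚ, ¬ HasRationalTwoTorsionX W x) (h8 : minimalDiscriminantInt W % 8 = 1)
    {β : AlgebraicClosure ℚ} (hβ : aeval β W.twoTorsionPolynomial.toPoly = 0) :
    3 ≤ {v : HeightOneSpectrum (𝓞 ↥(IntermediateField.adjoin ℚ ({β} : Set (AlgebraicClosure ℚ)))) |
      ((2 : ℕ) : 𝓞 ↥(IntermediateField.adjoin ℚ ({β} : Set (AlgebraicClosure ℚ)))) ∈ v.asIdeal}.ncard :=
  three_le_ncard_adjoin_root_twoTorsionPolynomial_of_onKilfordStratumAtTwo W hord ht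
    ((onKilfordStratumAtTwo_iff_minimalDiscriminantInt_emod_eight W hord).mpr h8) hβ

end Adjoin

/-! ## §3 The parity obstruction and the layer-`(n, n+1)` doors, RE-STAMPED with `h3p` discharged -/

section Doors

open CongruenceSubgroup
  Literature.NumberTheory.IwasawaTheory Literature.NumberTheory.GaloisRepresentations
  Literature.NumberTheory.EllipticCurves.ModularForms
  Literature.NumberTheory.EllipticCurves.Rank1Residual
  Literature.NumberTheory.EllipticCurves.Module
  Summit.BirchSwinnertonDyer.Rank1Residual
  Summit.BirchSwinnertonDyer.Rank1Residual.X1.MuLambda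
  Summit.BirchSwinnertonDyer.Rank1Residual.X5
  Summit.BirchSwinnertonDyer.BirchSwinnertonDyer.Theorems.Rank1ResidualX1Defs
  Summit.BirchSwinnertonDyer.BirchSwinnertonDyer.Theses.AlignedTransportAtTwo
  Summit.BirchSwinnertonDyer.BirchSwinnertonDyer.Theorems.AlignedTransportAtTwoCubicLayerOneDoors

variable (W : WeierstrassCurve ℚ) [W.IsElliptic] [W.IsGloballyMinimal]

/-- **NO LAYER-`(0,1)` CERTIFICATE ON THE WHOLE KILFORD SUB-CELL — kernel, no displayed bit.** `W/ℚ` globally minimal, good ORDINARY at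
`2`, no rational `2`-torsion abscissa, `Δ_W < 0`, ON the Kilford stratum; `β` a root of the `2`-division cubic. Then for every cyclotomic
`ℤ₂`-extension `κP` of `ℚ(β)`: `e₀(κP) + 1 ≤ e₁(κP)` and `e₁(κP) ≠ 0` — `h(ℚ(β, √2))` is even, so neither the odd-discriminant parity door nor
Chevalley's non-norm-unit door of cell bsd-2adic can certify `μ₂(ℚ(β)) = 0` there (att-p5 g25 `classNumberPExp_one_ne_zero_seedCubicField`, its
`h3p` now supplied by §2). [cite: Lang1990, Ch. 13 §4, Lemma 4.1] [cite: NeukirchANT1999, Ch. II §8, (8.1)–(8.3)] [cite: Fukuda1994, Thm. 1 (1), p. 264] -/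
theorem classNumberPExp_one_ne_zero_seedCubicField_of_onKilfordStratumAtTwo (hord : IsOrdinaryAt W 2)
    (ht : ∀ x : ℚ, ¬ HasRationalTwoTorsionX W x) (hΔ : W.Δ < 0) (hs : OnKilfordStratumAtTwo W)
    {β : AlgebraicClosure ℚ} (hβ : aeval β W.twoTorsionPolynomial.toPoly = 0)
    (κP : ZpExtension ↥(IntermediateField.adjoin ℚ ({β} : Set (AlgebraicClosure ℚ))) 2) (hκP : κP.IsCyclotomic) :
    classNumberPExp κP 0 + 1 ≤ classNumberPExp κP 1 ∧ classNumberPExp κP 1 ≠ 0 :=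
  classNumberPExp_one_ne_zero_seedCubicField W hΔ ht hβ
    (three_le_ncard_adjoin_root_twoTorsionPolynomial_of_onKilfordStratumAtTwo W hord ht hs hβ) κP hκP

/-- The same with the decidable hypothesis `Δ_min(W) % 8 = 1` in place of «ON the stratum». [cite: Lang1990, Ch. 13 §4, Lemma 4.1]
[cite: Serre1973, Ch. II §3.3 Thm. 4] -/
theorem classNumberPExp_one_ne_zero_seedCubicField_of_minimalDiscriminantInt_emod_eight (hord : IsOrdinaryAt W 2)
    (ht : ∀ x : ℚ, ¬ HasRationalTwoTorsionX W x) (hΔ : W.Δ < 0) (h8 : minimalDiscriminantInt W % 8 = 1)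
    {β : AlgebraicClosure ℚ} (hβ : aeval β W.twoTorsionPolynomial.toPoly = 0)
    (κP : ZpExtension ↥(IntermediateField.adjoin ℚ ({β} : Set (AlgebraicClosure ℚ))) 2) (hκP : κP.IsCyclotomic) :
    classNumberPExp κP 0 + 1 ≤ classNumberPExp κP 1 ∧ classNumberPExp κP 1 ≠ 0 :=
  classNumberPExp_one_ne_zero_seedCubicField_of_onKilfordStratumAtTwo W hord ht hΔ
    ((onKilfordStratumAtTwo_iff_minimalDiscriminantInt_emod_eight W hord).mpr h8) hβ κP hκP

/-- **THE LAYER-`(n, n+1)` DOOR ON THE KILFORD STRATUM, ORDER FORM — `h3p` discharged.** PRINT⁵ {Kato 17.4 (1)(2) at `2` (`h17`), Greenberg 4.1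
(`hGr`), period unit (`hper`), modularity (`hmod`), GZK (`hGZK`)} + MuIneqʳ (`hI`, the registered stub VERBATIM) + the cell hypotheses (good
ordinary at `2`, no rational `2`-torsion abscissa, `Δ_W < 0`, `r_an = 0`, analytic `μ₂ = 0` on the even branch, `BSD₂(W)`) + ON the Kilford stratum
+ `β` a root of the `2`-division cubic + for every cyclotomic `κP` of `ℚ(β)` SOME `n` with `e_{n+1}(κP) = e_n(κP)` ⟹ `MC₂(W)`
(att-p5 g25 `mazurMainConjecture_two_of_muIneqRel_of_threePrimes_of_classNumberPExp_succ_eq` ∘ §2). [cite: Fukuda1994, Thm. 1 (1), p. 264]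
[cite: Kato2004Asterisque, Thm. 17.4 (1)(2) (p. 273)] [cite: GreenbergLNM1716, Thm. 4.1 (p. 102) and Conj. 1.11 (p. 58)] [cite: NeukirchANT1999, Ch. II §8] -/
theorem mazurMainConjecture_two_of_muIneqRel_of_onKilfordStratumAtTwo_of_classNumberPExp_succ_eq
    (h17 : ∀ [NeZero (W.conductorNorm ℤ)] (f : CuspForm (Gamma0 (W.conductorNorm ℤ)) 2),
      kato_divisibility_allPrimes W 2 (f := f))
    (hGr : Greenberg1999.thm41_charValue_rankZero_anyPrime)
    (hper : realPeriodRat_eq_unit_mul_plusPeriod_two) (hmod : nonempty_modularParametrizationData)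
    (hGZK : rank_eq_analyticRank_of_analyticRank_le_one)
    (hI : ∀ (W : WeierstrassCurve ℚ) [W.IsElliptic] [W.IsGloballyMinimal], IsOrdinaryAt W 2 →
      (∀ x : ℚ, ¬ HasRationalTwoTorsionX W x) →
      ∀ (κ : ZpExtension ℚ 2) (γ : Field.absoluteGaloisGroup ℚ), κ.IsCyclotomic →
      κ.IsTopGenerator γ → IsCyclotomicVariable 2 γ →
      ∀ ⦃N : ℕ⦄ [NeZero N] (f : CuspForm (Gamma0 N) 2), IsNewformOf W f →
      ∀ Gp : IwasawaAlgebra 2, iwasawaToPowerSeries 2 Gp = padicLFunction f (unitRoot W 2 : ℚ_[2]) →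
      ∀ (D : W.SelmerDualData κ γ) (Yr : W.FineSelmerDualDataRelaxedInf κ γ),
        lengthAt (IwasawaAlgebra 2) D.X ⟨IwasawaAlgebra.augIdealP 2, IwasawaAlgebra.isPrime_augIdealP_holds 2⟩ ≤
          lengthAt (IwasawaAlgebra 2) (IwasawaAlgebra 2 ⧸ Ideal.span {Gp})
              ⟨IwasawaAlgebra.augIdealP 2, IwasawaAlgebra.isPrime_augIdealP_holds 2⟩ +
            lengthAt (IwasawaAlgebra 2) Yr.X ⟨IwasawaAlgebra.augIdealP 2, IwasawaAlgebra.isPrime_augIdealP_holds 2⟩)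
    (hord : IsOrdinaryAt W 2) (ht : ∀ x : ℚ, ¬ HasRationalTwoTorsionX W x) (hΔ : W.Δ < 0) (hr : W.analyticRank = 0)
    (hμan : ∀ ⦃N : ℕ⦄ [NeZero N] (f : CuspForm (Gamma0 N) 2), IsNewformOf W f →
      ∀ G : IwasawaAlgebra 2, IsEvenBranchLiftAtTwo W f G → red G ≠ 0)
    (hbsd : BSDp W 2) (hs : OnKilfordStratumAtTwo W)
    {β : AlgebraicClosure ℚ} (hβ : aeval β W.twoTorsionPolynomial.toPoly = 0)
    (hcert : ∀ κP : ZpExtension ↥(IntermediateField.adjoin ℚ ({β} : Set (AlgebraicClosure ℚ))) 2, κP.IsCyclotomic →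
      ∃ n : ℕ, classNumberPExp κP (n + 1) = classNumberPExp κP n) :
    MazurMainConjecture W 2 :=
  mazurMainConjecture_two_of_muIneqRel_of_threePrimes_of_classNumberPExp_succ_eq W h17 hGr hper hmod hGZK hI hord ht hΔ hr hμan hbsd hβ
    (three_le_ncard_adjoin_root_twoTorsionPolynomial_of_onKilfordStratumAtTwo W hord ht hs hβ) hcert

/-- **THE LAYER-`(n, n+1)` DOOR ON THE KILFORD STRATUM, RANK FORM — `h3p` discharged**: the same with ONE equality of `2`-RANKS
`rank₂ Cl(ℚ(β)_{n+1}) = rank₂ Cl(ℚ(β)_n)` for some `n`, for every cyclotomic `κP` (Fukuda 1994 Thm. 1 (2), tree `_holds`).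
[cite: Fukuda1994, Thm. 1 (2), p. 264] [cite: Kato2004Asterisque, Thm. 17.4 (1)(2) (p. 273)] [cite: GreenbergLNM1716, Thm. 4.1 (p. 102) and Conj. 1.11 (p. 58)]
[cite: NeukirchANT1999, Ch. II §8] -/
theorem mazurMainConjecture_two_of_muIneqRel_of_onKilfordStratumAtTwo_of_classGroupPRank_succ_eq
    (h17 : ∀ [NeZero (W.conductorNorm ℤ)] (f : CuspForm (Gamma0 (W.conductorNorm ℤ)) 2),
      kato_divisibility_allPrimes W 2 (f := f))
    (hGr : Greenberg1999.thm41_charValue_rankZero_anyPrime)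
    (hper : realPeriodRat_eq_unit_mul_plusPeriod_two) (hmod : nonempty_modularParametrizationData)
    (hGZK : rank_eq_analyticRank_of_analyticRank_le_one)
    (hI : ∀ (W : WeierstrassCurve ℚ) [W.IsElliptic] [W.IsGloballyMinimal], IsOrdinaryAt W 2 →
      (∀ x : ℚ, ¬ HasRationalTwoTorsionX W x) →
      ∀ (κ : ZpExtension ℚ 2) (γ : Field.absoluteGaloisGroup ℚ), κ.IsCyclotomic →
      κ.IsTopGenerator γ → IsCyclotomicVariable 2 γ →
      ∀ ⦃N : ℕ⦄ [NeZero N] (f : CuspForm (Gamma0 N) 2), IsNewformOf W f →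
      ∀ Gp : IwasawaAlgebra 2, iwasawaToPowerSeries 2 Gp = padicLFunction f (unitRoot W 2 : ℚ_[2]) →
      ∀ (D : W.SelmerDualData κ γ) (Yr : W.FineSelmerDualDataRelaxedInf κ γ),
        lengthAt (IwasawaAlgebra 2) D.X ⟨IwasawaAlgebra.augIdealP 2, IwasawaAlgebra.isPrime_augIdealP_holds 2⟩ ≤
          lengthAt (IwasawaAlgebra 2) (IwasawaAlgebra 2 ⧸ Ideal.span {Gp})
              ⟨IwasawaAlgebra.augIdealP 2, IwasawaAlgebra.isPrime_augIdealP_holds 2⟩ +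
            lengthAt (IwasawaAlgebra 2) Yr.X ⟨IwasawaAlgebra.augIdealP 2, IwasawaAlgebra.isPrime_augIdealP_holds 2⟩)
    (hord : IsOrdinaryAt W 2) (ht : ∀ x : ℚ, ¬ HasRationalTwoTorsionX W x) (hΔ : W.Δ < 0) (hr : W.analyticRank = 0)
    (hμan : ∀ ⦃N : ℕ⦄ [NeZero N] (f : CuspForm (Gamma0 N) 2), IsNewformOf W f →
      ∀ G : IwasawaAlgebra 2, IsEvenBranchLiftAtTwo W f G → red G ≠ 0)
    (hbsd : BSDp W 2) (hs : OnKilfordStratumAtTwo W)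
    {β : AlgebraicClosure ℚ} (hβ : aeval β W.twoTorsionPolynomial.toPoly = 0)
    (hcert : ∀ κP : ZpExtension ↥(IntermediateField.adjoin ℚ ({β} : Set (AlgebraicClosure ℚ))) 2, κP.IsCyclotomic →
      ∃ n : ℕ, classGroupPRank κP (n + 1) = classGroupPRank κP n) :
    MazurMainConjecture W 2 :=
  mazurMainConjecture_two_of_muIneqRel_of_threePrimes_of_classGroupPRank_succ_eq W h17 hGr hper hmod hGZK hI hord ht hΔ hr hμan hbsd hβ
    (three_le_ncard_adjoin_root_twoTorsionPolynomial_of_onKilfordStratumAtTwo W hord ht hs hβ) hcert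

/-- **THE RANK DOOR with the decidable hypothesis `Δ_min(W) % 8 = 1`** (the form the per-seed rows consume: `Δ_min` is `decide`d from the
minimal model). [cite: Fukuda1994, Thm. 1 (2), p. 264] [cite: Serre1973, Ch. II §3.3 Thm. 4] [cite: Kato2004Asterisque, Thm. 17.4 (1)(2) (p. 273)] -/
theorem mazurMainConjecture_two_of_muIneqRel_of_minimalDiscriminantInt_emod_eight_of_classGroupPRank_succ_eq
    (h17 : ∀ [NeZero (W.conductorNorm ℤ)] (f : CuspForm (Gamma0 (W.conductorNorm ℤ)) 2),
      kato_divisibility_allPrimes W 2 (f := f))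
    (hGr : Greenberg1999.thm41_charValue_rankZero_anyPrime)
    (hper : realPeriodRat_eq_unit_mul_plusPeriod_two) (hmod : nonempty_modularParametrizationData)
    (hGZK : rank_eq_analyticRank_of_analyticRank_le_one)
    (hI : ∀ (W : WeierstrassCurve ℚ) [W.IsElliptic] [W.IsGloballyMinimal], IsOrdinaryAt W 2 →
      (∀ x : ℚ, ¬ HasRationalTwoTorsionX W x) →
      ∀ (κ : ZpExtension ℚ 2) (γ : Field.absoluteGaloisGroup ℚ), κ.IsCyclotomic →
      κ.IsTopGenerator γ → IsCyclotomicVariable 2 γ →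
      ∀ ⦃N : ℕ⦄ [NeZero N] (f : CuspForm (Gamma0 N) 2), IsNewformOf W f →
      ∀ Gp : IwasawaAlgebra 2, iwasawaToPowerSeries 2 Gp = padicLFunction f (unitRoot W 2 : ℚ_[2]) →
      ∀ (D : W.SelmerDualData κ γ) (Yr : W.FineSelmerDualDataRelaxedInf κ γ),
        lengthAt (IwasawaAlgebra 2) D.X ⟨IwasawaAlgebra.augIdealP 2, IwasawaAlgebra.isPrime_augIdealP_holds 2⟩ ≤
          lengthAt (IwasawaAlgebra 2) (IwasawaAlgebra 2 ⧸ Ideal.span {Gp})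
              ⟨IwasawaAlgebra.augIdealP 2, IwasawaAlgebra.isPrime_augIdealP_holds 2⟩ +
            lengthAt (IwasawaAlgebra 2) Yr.X ⟨IwasawaAlgebra.augIdealP 2, IwasawaAlgebra.isPrime_augIdealP_holds 2⟩)
    (hord : IsOrdinaryAt W 2) (ht : ∀ x : ℚ, ¬ HasRationalTwoTorsionX W x) (hΔ : W.Δ < 0) (hr : W.analyticRank = 0)
    (hμan : ∀ ⦃N : ℕ⦄ [NeZero N] (f : CuspForm (Gamma0 N) 2), IsNewformOf W f →
      ∀ G : IwasawaAlgebra 2, IsEvenBranchLiftAtTwo W f G → red G ≠ 0)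
    (hbsd : BSDp W 2) (h8 : minimalDiscriminantInt W % 8 = 1)
    {β : AlgebraicClosure ℚ} (hβ : aeval β W.twoTorsionPolynomial.toPoly = 0)
    (hcert : ∀ κP : ZpExtension ↥(IntermediateField.adjoin ℚ ({β} : Set (AlgebraicClosure ℚ))) 2, κP.IsCyclotomic →
      ∃ n : ℕ, classGroupPRank κP (n + 1) = classGroupPRank κP n) :
    MazurMainConjecture W 2 :=
  mazurMainConjecture_two_of_muIneqRel_of_onKilfordStratumAtTwo_of_classGroupPRank_succ_eq W h17 hGr hper hmod hGZK hI hord ht hΔ hr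
    hμan hbsd ((onKilfordStratumAtTwo_iff_minimalDiscriminantInt_emod_eight W hord).mpr h8) hβ hcert

end Doors

end Summit.BirchSwinnertonDyer.BirchSwinnertonDyer.Theorems.AlignedTransportAtTwoCubicKilfordPrimes

end
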